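import Summits.HodgeConjecture.HodgeConjecture.Theorems.F0P3SpectralPacketFactorisationG   -- ★ (N) FILE 3k p843180 (this seat): `toPureTensor_loc_eq_locAll` (+ ★ 3j Satake `trPkt_loc_comp_eq_measureReal_mul_evpAtψ`, ★ 3h `trHSψ` `evpHψ` `endoTrPkt`, ★ 3g `imageG`)
import Summits.HodgeConjecture.HodgeConjecture.Theorems.F0P3SpectralPacketHTraceIndep      -- ★ (N) FILE 3h′ p842969 (this seat): `SpectralPacketH.trH_eq_of_isUnramified₂` ((TF-ind)-H discharged)
import HarnessLib

/-!
# (N) DEFS, FILE 3n — THE PACKET-FACTORISATION CLAUSE (P1)-H OF `K9SpectralLetter` AT THE TUPLE, REDUCED TO THE CHARACTER IDENTITIES OF `ρ` AT THE PINNED PARTNER: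
# `Tr ρ(f′^H) = Tr^{endo} ρ_{S,∞}(f′_{S,∞}) · ∏_{v ∈ supp f^S} vol′(K′_v)·t(Π(ρ))_v(f^S_v)` (Rogawski §14.6 p. 243 l. 9–17, §14.3 p. 233, §14.6 p. 237 l. −8, §13.1 Thm. 13.1.1 (2), Prop. 13.1.4, §13.7 p. 206)

Cell `hodgecm-mathlib` (D-0151), F0∕P3 «U3-mult», crux H413 (`stmt-HodgeConjecture-24833`), route of record `HCCMUnconditional`.  (N) lead pen F0P3a-p01 (g12); BOARD rev. 2
`F0/P3a/F0P3a-p01/g12/BOARD-N-DEFS-handoff.F0P3a-p01g12.md` (o1); LEAD F0P3a-plan (g10).  PROOF lane (`--kind proof --supports stmt-HodgeConjecture-24833 --as helper`): theorems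
only; no `def`, no instance, no notation, no named fact, no `sorry`; never imports a `Cruxes/…/Lines` module (the kit `𝔨` enters only through `ψ` and the pin (xi″-c) data: an
unramified₂ pair tensor `T^H` presenting the T1g-chosen partner `f′^H = T^H.eval`, ★ `IsPinned.deltaTransfer_tensors`).  Twin of ★ FILE 3k on the `H`-side.
HONEST LABEL: HC_CM is proved only modulo the printed citations until rung 0 closes; this file reduces (P1)-H at the (N) tuple to the LOCAL CHARACTER IDENTITIES of `ρ` at the
pinned pair `(T^H_v, (f′_{S,∞} ⊗ f^S)_v)` read through `ψ_v` (print: Thm. 13.1.1 (2) ∕ Prop. 13.1.4 against the transported transfer factor `Δ″_v(γ_H, γ′) = Δ_v(γ_H, ψ_v(γ′))`,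
p. 237 l. −8; taken here as the place-wise hypothesis `hchar`, NAMED as a law by the next def-lane brick exactly as ★ FILE 3m named ★ FILE 3k's `harchId`) and ONE archimedean
identity `harchId` (Prop. 14.4.2 ∕ 12.3.3 at the packet), modulo (TF-1)-H, (TF-1) for `Π(ρ)`, (ℓ4), admissibility, the Gelfand bound and the pin's level clause off `S₀ ⊆ S`.

THE MATHEMATICS.  `f′^H = T^H.eval` is an unramified₂ pure tensor, so `Tr ρ(f′^H) = Tr ρ_∞(T^H.arch) · ∏_{v ∈ T^H.S ∪ S ∪ T} Tr ρ_v(T^H_v)` (★ FILE 3h′ `trH_eq_of_isUnramified₂`).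
By `hchar`, `Tr ρ_v(T^H_v) = Σ_{π ∈ ξ_H(ρ_v)} ⟨ρ_v, π⟩ Tr π((f′_{S,∞} ⊗ f^S)_v ∘ ψ_v⁻¹)` (★ FILE 3h `endoTrPkt`): at `v ∈ S` this is the finite factor of ★ FILE 3h `trHSψ`; at
`v ∈ T = supp f^S` (off `S ⊇ S₀ ∪ ram ρ`) the argument is bi-`K_v`-invariant, only the unramified member `π⁰` of `ξ_H(ρ_v)` survives (Gelfand bound) with `⟨ρ_v, π⁰⟩ = ⟨1, π⁰⟩ = 1`
((ℓ4)) — so the endoscopic sum IS `Tr Π(ρ)_v` (§1 `endoTrPkt_eq_trPkt_of_isLevel`) `= vol′(K′_v) · t(Π(ρ))_v(f^S_v)` (★ FILE 3j at the image packet ★ `imageG ρ`); elsewhere the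
argument is `𝟙_{K_v}` and `Tr Π(ρ)_v(𝟙_{K_v}) = 1` ((TF-1) for `Π(ρ)`).

References: [Rogawski1990] §14.6 p. 243 l. 9–17, p. 237 l. −8, §14.3 p. 233, §13.1 Thm. 13.1.1 (2) p. 198, Prop. 13.1.4 p. 199, §13.3 p. 203, §13.7 p. 206; [FlathCorvallis1979] Thm. 3;
[CartierCorvallis1979] §IV.1 Cor. 4.1.
-/

set_option autoImplicit false
-- the mandated namespace repeats `HodgeConjecture.HodgeConjecture`, as in every `Theorems/*.lean` of this sub-problem
set_option linter.dupNamespace false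

noncomputable section

open NumberField IsDedekindDomain MeasureTheory Filter
open scoped Matrix MatrixGroups

open Literature.NumberTheory Literature.NumberTheory.Automorphic Literature.NumberTheory.Automorphic.UnitaryGroup
open Literature.NumberTheory.Rogawski1990 Literature.NumberTheory.GaloisRepresentations
open Literature.RepresentationTheory.BorelWallach2000 Literature.RepresentationTheory.KonnoKonno2007
open Summit.HodgeConjecture.HodgeConjecture.Cruxes.H413.F0P3InnerFormClassificationV6 (TestH splitForm)
open Summit.HodgeConjecture.HodgeConjecture.Cruxes.H413.F0P3LocalPacketKit
open Summit.HodgeConjecture.HodgeConjecture.Cruxes.H413.F0P3ArchPacketKit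
open Summit.HodgeConjecture.HodgeConjecture.Cruxes.H413.F0P3EigencharacterTransport
open Summit.HodgeConjecture.HodgeConjecture.Cruxes.H413.F0P3TraceFactorisationZeroBranch
open Summit.HodgeConjecture.HodgeConjecture.Cruxes.H413.F0P3SemilocalTestFunctionsOfRecord (TestS₀ toPureTensor locAll locAll_of_mem locAll_of_not_mem)
open Summit.HodgeConjecture.HodgeConjecture.Cruxes.H413.F0P3TestFunctionsOfRecord (Unr₀)

/-! ## §1 On `C_c(K_v\G_v/K_v)` the endoscopic sum of `ρ_v` IS `Tr Π(ρ)_v` [Thm. 13.1.1 (2); p. 203 l. 1–3] -/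

namespace Summit.HodgeConjecture.HodgeConjecture.Cruxes.H413.F0P3LocalPacketKit.LocalPacketKit

variable {L : Type} [Field L] [NumberField L] [IsCMField L] {H' : Matrix (Fin 3) (Fin 3) L} {v : HeightOneSpectrum (𝓞 ↥(maximalRealSubfield L))}

/-- **`Σ_{π ∈ ξ_H(ρ)} ⟨ρ, π⟩ Tr π(h) = Tr ξ_H(ρ)(h)` on bi-`K_v`-invariant `h`** when `ξ_H(ρ)` is unramified: under (ℓ4) and the Gelfand bound only the unramified member `π⁰`
contributes to either sum, and `⟨ρ, π⁰⟩ = ⟨1, π⁰⟩ = 1`. [cite: Rogawski1990, §13.1 Thm. 13.1.1 (2) p. 198; §13.3 p. 203 l. 1–3] [cite: CartierCorvallis1979, §IV.1 Cor. 4.1] -/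
theorem endoTrPkt_eq_trPkt_of_isLevel (𝔩 : LocalPacketKit L H' v)
    [MeasurableSpace ((UnitaryGroup.cmDatum L 3 H').Local v)] [BorelSpace ((UnitaryGroup.cmDatum L 3 H').Local v)]
    (ν : Measure ((UnitaryGroup.cmDatum L 3 H').Local v)) [ν.IsMulLeftInvariant] [IsFiniteMeasureOnCompacts ν]
    (h4 : 𝔩.UnramLaw) (ρ : 𝔩.PktH) (h : 𝔩.unr (𝔩.xiH ρ)) (hadm : ∀ π ∈ 𝔩.mem (𝔩.xiH ρ), π.IsAdmissible)
    (hgood : ∀ r : SmoothIrrep ((UnitaryGroup.cmDatum L 3 H').Local v), r.ρ.IsAdmissible →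
      Module.finrank ℂ (r.ρ.fixedPoints (cmLocalIntegralLevel L 3 H' v)) ≤ 1)
    {f : (UnitaryGroup.cmDatum L 3 H').Local v → ℂ} (hf : HasCompactSupport f) (hK : IsLevel (cmLocalIntegralLevel L 3 H' v) f) :
    𝔩.endoTrPkt ν ρ f = 𝔩.trPkt ν (𝔩.xiH ρ) f := by
  rw [𝔩.endoTrPkt_eq, 𝔩.trPkt_eq]
  refine Finset.sum_congr rfl fun π hπ => ?_
  by_cases hs : π.IsSpherical (cmLocalIntegralLevel L 3 H' v)
  · -- the unramified member: `⟨ρ, π⁰⟩ = 1 = ⟨1, π⁰⟩`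
    have hπ0 : π = 𝔩.sph (𝔩.xiH ρ) h := (h4 _ h).2.2.1 π hπ hs
    subst hπ0
    rw [(h4 _ h).2.2.2.1, (h4 _ h).2.2.2.2 ρ rfl]
  · -- a non-spherical admissible member kills `h`
    have h0 : π.smoothTrace ν f = 0 := by
      induction π using IrrClass.ind with
      | h r =>
        rw [IrrClass.smoothTrace_mk]
        exact smoothTrace_eq_zero_of_finrank_le_one_of_not_isSpherical r.ρ ν ((IrrClass.isAdmissible_mk r).1 (hadm _ hπ))
          (hgood r ((IrrClass.isAdmissible_mk r).1 (hadm _ hπ))) (by rwa [IrrClass.isSpherical_mk] at hs) hf hK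
    rw [h0, mul_zero, mul_zero]

end Summit.HodgeConjecture.HodgeConjecture.Cruxes.H413.F0P3LocalPacketKit.LocalPacketKit

/-! ## §2 (P1)-H at the tuple: `Tr ρ` of the pinned partner `f′^H` of `f′_{S,∞} ⊗ f^S` [§14.6 p. 243 l. 9–17; §14.3 p. 233; p. 237 l. −8] -/

namespace Summit.HodgeConjecture.HodgeConjecture.Cruxes.H413.F0P3SpectralPacket.SpectralPacketH

open Summit.HodgeConjecture.HodgeConjecture.Cruxes.H413.F0P3GlobalPacket
open Summit.HodgeConjecture.HodgeConjecture.Cruxes.H413.F0P3ArchPacketKit.ArchPacketKitH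

variable {L : Type} [Field L] [NumberField L] [IsCMField L] {H : Matrix (Fin 3) (Fin 3) L} {ι : L →+* ℂ} {T : GL (Fin 3) ℂ}
  {hT : (T : Matrix (Fin 3) (Fin 3) ℂ)ᴴ * H.map ι * (T : Matrix (Fin 3) (Fin 3) ℂ) = Literature.Geometry.ComplexHyperbolic.BallModel.J}
  {𝔩 : ∀ v : HeightOneSpectrum (𝓞 ↥(maximalRealSubfield L)), LocalPacketKit L (splitForm L 3) v} {𝔞 : ArchPacketKit} {𝔞H : ArchPacketKitH 𝔞}
  {DiscH : GlobalPacketH 𝔩 → 𝔞H.PktInfH → Prop}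
  [∀ v : HeightOneSpectrum (𝓞 ↥(maximalRealSubfield L)), MeasurableSpace ((cmDatum L 3 (splitForm L 3)).Local v)]
  [∀ v : HeightOneSpectrum (𝓞 ↥(maximalRealSubfield L)), BorelSpace ((cmDatum L 3 (splitForm L 3)).Local v)]
  [∀ v : HeightOneSpectrum (𝓞 ↥(maximalRealSubfield L)), MeasurableSpace ((cmDatum L 3 H).Local v)]
  [∀ v : HeightOneSpectrum (𝓞 ↥(maximalRealSubfield L)), BorelSpace ((cmDatum L 3 H).Local v)]
  [∀ v : HeightOneSpectrum (𝓞 ↥(maximalRealSubfield L)), MeasurableSpace ((cmDatum L 2 (splitForm L 2)).Local v × (cmDatum L 1 (splitForm L 1)).Local v)]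
  [∀ v : HeightOneSpectrum (𝓞 ↥(maximalRealSubfield L)), BorelSpace ((cmDatum L 2 (splitForm L 2)).Local v × (cmDatum L 1 (splitForm L 1)).Local v)]
  {νG' : ∀ v : HeightOneSpectrum (𝓞 ↥(maximalRealSubfield L)), Measure ((cmDatum L 3 H).Local v)}
  [∀ v, (νG' v).IsMulLeftInvariant] [∀ v, IsFiniteMeasureOnCompacts (νG' v)]
  {νH : ∀ v : HeightOneSpectrum (𝓞 ↥(maximalRealSubfield L)), Measure ((cmDatum L 2 (splitForm L 2)).Local v × (cmDatum L 1 (splitForm L 1)).Local v)}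
  [∀ v, (νH v).IsMulLeftInvariant] [∀ v, IsFiniteMeasureOnCompacts (νH v)]
  {archTrH : 𝔞H.CinfH → (UnitaryGroup.arch (↥(maximalRealSubfield L)) L (IsCMField.complexConj L) 2 (splitForm L 2) ×
    UnitaryGroup.arch (↥(maximalRealSubfield L)) L (IsCMField.complexConj L) 1 (splitForm L 1) → ℂ) → ℂ}

/-- **(P1)-H AT THE TUPLE, PRODUCT FORM**: for the record tensor `f′ = f′_{S,∞} ⊗ f^S` (`toPureTensor S fS fT`) and ANY unramified₂ pure tensor `T^H` on `H(𝔸)` presenting the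
T1g-chosen partner `f′^H = T^H.eval` (pin (xi″-c), ★ `IsPinned.deltaTransfer_tensors`) whose local factors obey the CHARACTER IDENTITIES of `ρ` against the factors of `f′`
(`hchar`: Thm. 13.1.1 (2) ∕ Prop. 13.1.4 at the `Δ″_v`-pair `(T^H_v, f′_v)` read through `ψ_v`, p. 237 l. −8), with `ram ρ ∪ S₀ ⊆ S`:
`Tr ρ(f′^H) = Tr ρ_∞(T^H.arch) · (∏_{v ∈ S} Σ_{π ∈ ξ_H(ρ_v)} ⟨ρ_v, π⟩ Tr π(f′_v ∘ ψ_v⁻¹)) · ∏_{v ∈ supp f^S} vol′(K′_v) · evpH ρ v (f^S_v)`.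
[cite: Rogawski1990, §14.6 p. 243 l. 9–17; §14.3 p. 233; §13.1 Thm. 13.1.1 (2) p. 198; §13.7 p. 206] [cite: FlathCorvallis1979, Thm. 3] [cite: CartierCorvallis1979, §IV.1 Cor. 4.1] -/
theorem trH_partner_eq_prod (ρ : SpectralPacketH 𝔩 𝔞 𝔞H DiscH)
    (ψ : ∀ v : HeightOneSpectrum (𝓞 ↥(maximalRealSubfield L)), (cmDatum L 3 H).Local v ≃ₜ* (cmDatum L 3 (splitForm L 3)).Local v)
    (h1 : ρ.UnramTraceOneH νH) (hadmH : ∀ (v : HeightOneSpectrum (𝓞 ↥(maximalRealSubfield L))), ∀ σ ∈ (𝔩 v).memH (ρ.fin.loc v), σ.IsAdmissible)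
    (harch : ∀ (c : 𝔞H.CinfH) (k : ℂ) (f : UnitaryGroup.arch (↥(maximalRealSubfield L)) L (IsCMField.complexConj L) 2 (splitForm L 2) ×
      UnitaryGroup.arch (↥(maximalRealSubfield L)) L (IsCMField.complexConj L) 1 (splitForm L 1) → ℂ), archTrH c (k • f) = k * archTrH c f)
    (h1G : ρ.imageG.UnramTraceOne fun v => (νG' v).map (ψ v))
    (h4 : ∀ v : HeightOneSpectrum (𝓞 ↥(maximalRealSubfield L)), (𝔩 v).UnramLaw)
    (hadm : ∀ (v : HeightOneSpectrum (𝓞 ↥(maximalRealSubfield L))), ∀ π ∈ (𝔩 v).mem (ρ.imageG.loc v), π.IsAdmissible)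
    (S₀ : Finset (HeightOneSpectrum (𝓞 ↥(maximalRealSubfield L))))
    (hgood : ∀ v ∉ S₀, ∀ r : SmoothIrrep ((UnitaryGroup.cmDatum L 3 (splitForm L 3)).Local v), r.ρ.IsAdmissible →
      Module.finrank ℂ (r.ρ.fixedPoints (cmLocalIntegralLevel L 3 (splitForm L 3) v)) ≤ 1)
    (hψK : ∀ v ∉ S₀, (cmLocalIntegralLevel L 3 H v).map (ψ v : (cmDatum L 3 H).Local v →* (cmDatum L 3 (splitForm L 3)).Local v) =
      cmLocalIntegralLevel L 3 (splitForm L 3) v)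
    (hμK : ∀ v : HeightOneSpectrum (𝓞 ↥(maximalRealSubfield L)), (νG' v).real (cmLocalIntegralLevel L 3 H v : Set ((cmDatum L 3 H).Local v)) ≠ 0)
    (S : Finset (HeightOneSpectrum (𝓞 ↥(maximalRealSubfield L)))) (hS₀ : S₀ ⊆ S) (hram : ρ.ramFinsetH ⊆ S)
    (fS : TestS₀ L H ι T hT S) (fT : Unr₀ L H S)
    {TH : UnitaryGroup.PureTensor₂ L (splitForm L 2) (splitForm L 1)} (hTH : TH.IsUnramified₂)
    (hchar : ∀ v : HeightOneSpectrum (𝓞 ↥(maximalRealSubfield L)),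
      (𝔩 v).trPktH (νH v) (ρ.fin.loc v) (TH.loc v) = (𝔩 v).endoTrPkt ((νG' v).map (ψ v)) (ρ.fin.loc v) ((toPureTensor S fS fT).loc v ∘ (ψ v).symm))
    {FH : TestH L} (hFH : ⇑FH = TH.eval) :
    ρ.trH νH archTrH FH =
      𝔞H.trPktInfH archTrH ρ.inf TH.arch *
        ((∏ v ∈ S, (𝔩 v).endoTrPkt ((νG' v).map (ψ v)) (ρ.fin.loc v) (locAll fS fT v ∘ (ψ v).symm)) *
          ∏ v ∈ fT.T, (((νG' v).real (cmLocalIntegralLevel L 3 H v : Set ((cmDatum L 3 H).Local v)) : ℂ) *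
            ρ.evpHψ ψ (fun w => (νG' w).map (ψ w)) v (fT.loc v))) := by
  classical
  have hchar' : ∀ v, ρ.trFinAt v (νH v) (TH.loc v) = (𝔩 v).endoTrPkt ((νG' v).map (ψ v)) (ρ.fin.loc v) (locAll fS fT v ∘ (ψ v).symm) := fun v => by
    rw [← toPureTensor_loc_eq_locAll S fS fT v]
    exact hchar v
  -- `Tr ρ(f′^H)` as the product over `T^H.S ∪ (S ∪ T)`
  rw [ρ.trH_eq_of_isUnramified₂ h1 hadmH harch hTH hFH (TH.S ∪ (S ∪ fT.T)) Finset.subset_union_left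
    (fun v hv => Finset.mem_union_right _ (Finset.mem_union_left _ (hram hv)))]
  congr 1
  -- drop the places of `T^H.S` outside `S ∪ T`: there the `G′`-factor is `𝟙_{K′_v}`, the endoscopic sum is `Tr Π(ρ)_v(𝟙_{K_v}) = 1`
  rw [← Finset.prod_subset (Finset.subset_union_right : S ∪ fT.T ⊆ TH.S ∪ (S ∪ fT.T)) fun v _ hv => ?_]
  · rw [Finset.prod_union (Finset.disjoint_iff_ne.2 fun a ha b hb hab => Finset.disjoint_left.1 fT.hT hb (hab ▸ ha))]
    congr 1
    · exact Finset.prod_congr rfl fun v _ => hchar' v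
    · refine Finset.prod_congr rfl fun v hv => ?_
      have hvS : v ∉ S := fun h => Finset.disjoint_left.1 fT.hT hv h
      haveI : ((νG' v).map (ψ v)).IsMulLeftInvariant :=
        isMulLeftInvariant_map (ψ v : (cmDatum L 3 H).Local v →ₙ* (cmDatum L 3 (splitForm L 3)).Local v) (ψ v).continuous.measurable (ψ v).surjective
      haveI : IsFiniteMeasureOnCompacts ((νG' v).map (ψ v)) := Measure.IsFiniteMeasureOnCompacts.map (νG' v) (ψ v).toHomeomorph
      have hfe : HasCompactSupport (fT.loc v ∘ (ψ v).symm) ∧ IsLevel (cmLocalIntegralLevel L 3 (splitForm L 3) v) (fT.loc v ∘ (ψ v).symm) := by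
        have h := (hasCompactSupport_and_isLevel_comp_iff (ψ v) (cmLocalIntegralLevel L 3 H v) (fT.loc v ∘ (ψ v).symm)).1
          (by rw [comp_symm_comp]; exact ⟨fT.hcs v, fT.hlev v⟩)
        rwa [hψK v fun h => hvS (hS₀ h)] at h
      rw [hchar' v, locAll_of_not_mem fS fT hvS,
        (𝔩 v).endoTrPkt_eq_trPkt_of_isLevel ((νG' v).map (ψ v)) (h4 v) (ρ.fin.loc v) (ρ.unr_xiH_of_not_mem_ramFinsetH fun h => hvS (hram h))
          (by rw [← ρ.imageG_loc v]; exact hadm v) (hgood v fun h => hvS (hS₀ h)) hfe.1 hfe.2, ← ρ.imageG_loc v]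
      exact ρ.imageG.trPkt_loc_comp_eq_measureReal_mul_evpAtψ ψ νG' (h4 v) (hadm v) (hgood v fun h => hvS (hS₀ h)) (hψK v fun h => hvS (hS₀ h))
        (hμK v) (fun h => hvS (hram h)) (fT.hcs v) (fT.hlev v)
  · have hvS : v ∉ S := fun h => hv (Finset.mem_union_left _ h)
    have hvT : v ∉ fT.T := fun h => hv (Finset.mem_union_right _ h)
    haveI : ((νG' v).map (ψ v)).IsMulLeftInvariant :=
      isMulLeftInvariant_map (ψ v : (cmDatum L 3 H).Local v →ₙ* (cmDatum L 3 (splitForm L 3)).Local v) (ψ v).continuous.measurable (ψ v).surjective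
    haveI : IsFiniteMeasureOnCompacts ((νG' v).map (ψ v)) := Measure.IsFiniteMeasureOnCompacts.map (νG' v) (ψ v).toHomeomorph
    rw [hchar' v, locAll_of_not_mem fS fT hvS, fT.loc_eq v hvT]
    -- `𝟙_{K′_v} ∘ ψ_v⁻¹ = 𝟙_{K_v}`
    have hind1 : (((cmLocalIntegralLevel L 3 H v : Set ((cmDatum L 3 H).Local v)).indicator fun _ => (1 : ℂ)) ∘ (ψ v).symm) =
        (cmLocalIntegralLevel L 3 (splitForm L 3) v : Set ((cmDatum L 3 (splitForm L 3)).Local v)).indicator fun _ => 1 := by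
      funext g
      simp only [Function.comp_apply]
      rw [← hψK v fun h => hvS (hS₀ h)]
      by_cases hg : (ψ v).symm g ∈ (cmLocalIntegralLevel L 3 H v : Set ((cmDatum L 3 H).Local v))
      · rw [Set.indicator_of_mem hg, Set.indicator_of_mem]
        exact ⟨(ψ v).symm g, hg, (ψ v).apply_symm_apply g⟩
      · rw [Set.indicator_of_notMem hg, Set.indicator_of_notMem]
        rintro ⟨k, hk, hkg⟩
        exact hg (by rw [← hkg]; simpa using hk)
    have hKv := isCompact_isOpen_cmLocalIntegralLevel L 3 (splitForm L 3) v
    rw [hind1, (𝔩 v).endoTrPkt_eq_trPkt_of_isLevel ((νG' v).map (ψ v)) (h4 v) (ρ.fin.loc v) (ρ.unr_xiH_of_not_mem_ramFinsetH fun h => hvS (hram h))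
        (by rw [← ρ.imageG_loc v]; exact hadm v) (hgood v fun h => hvS (hS₀ h)) (indicator_mem_schwartzBruhat hKv.2 hKv.1).2
        (IsLevel.indicator hKv.2 hKv.1), ← ρ.imageG_loc v]
    exact h1G v (ρ.unr_xiH_of_not_mem_ramFinsetH fun h => hvS (hram h))

/-- **(P1)-H AT THE TUPLE, MODULO THE ARCHIMEDEAN IDENTITY** (`harchId`: `Tr ρ_∞(T^H.arch)` with the `H_∞`-characters equals the endoscopic archimedean sum of `ρ_∞` at `f′_∞` with the
compact-side characters `archTr′` — Prop. 14.4.2 ∕ 12.3.3 at the packet, named by the next brick): `Tr ρ(f′^H) = trHS S ρ f′_{S,∞} · ∏_{v ∈ supp f^S} vol′(K′_v) · evpH ρ v (f^S_v)` —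
the (P1) clause's `H`-shape with `hat f^S (t(ρ))` spelled as the Satake product (★ FILE 3h `trHSψ` is the tuple's `trHS`, `evpHψ` its `evpH`).
[cite: Rogawski1990, §14.6 p. 243 l. 9–17; §14.4 Prop. 14.4.2 p. 236; §12.3 Prop. 12.3.3 p. 178; §13.7 p. 206] [cite: FlathCorvallis1979, Thm. 3] -/
theorem trH_partner_eq_trHSψ_mul_prod (ρ : SpectralPacketH 𝔩 𝔞 𝔞H DiscH)
    (ψ : ∀ v : HeightOneSpectrum (𝓞 ↥(maximalRealSubfield L)), (cmDatum L 3 H).Local v ≃ₜ* (cmDatum L 3 (splitForm L 3)).Local v)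
    (h1 : ρ.UnramTraceOneH νH) (hadmH : ∀ (v : HeightOneSpectrum (𝓞 ↥(maximalRealSubfield L))), ∀ σ ∈ (𝔩 v).memH (ρ.fin.loc v), σ.IsAdmissible)
    (harch : ∀ (c : 𝔞H.CinfH) (k : ℂ) (f : UnitaryGroup.arch (↥(maximalRealSubfield L)) L (IsCMField.complexConj L) 2 (splitForm L 2) ×
      UnitaryGroup.arch (↥(maximalRealSubfield L)) L (IsCMField.complexConj L) 1 (splitForm L 1) → ℂ), archTrH c (k • f) = k * archTrH c f)
    (h1G : ρ.imageG.UnramTraceOne fun v => (νG' v).map (ψ v))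
    (h4 : ∀ v : HeightOneSpectrum (𝓞 ↥(maximalRealSubfield L)), (𝔩 v).UnramLaw)
    (hadm : ∀ (v : HeightOneSpectrum (𝓞 ↥(maximalRealSubfield L))), ∀ π ∈ (𝔩 v).mem (ρ.imageG.loc v), π.IsAdmissible)
    (S₀ : Finset (HeightOneSpectrum (𝓞 ↥(maximalRealSubfield L))))
    (hgood : ∀ v ∉ S₀, ∀ r : SmoothIrrep ((UnitaryGroup.cmDatum L 3 (splitForm L 3)).Local v), r.ρ.IsAdmissible →
      Module.finrank ℂ (r.ρ.fixedPoints (cmLocalIntegralLevel L 3 (splitForm L 3) v)) ≤ 1)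
    (hψK : ∀ v ∉ S₀, (cmLocalIntegralLevel L 3 H v).map (ψ v : (cmDatum L 3 H).Local v →* (cmDatum L 3 (splitForm L 3)).Local v) =
      cmLocalIntegralLevel L 3 (splitForm L 3) v)
    (hμK : ∀ v : HeightOneSpectrum (𝓞 ↥(maximalRealSubfield L)), (νG' v).real (cmLocalIntegralLevel L 3 H v : Set ((cmDatum L 3 H).Local v)) ≠ 0)
    (S : Finset (HeightOneSpectrum (𝓞 ↥(maximalRealSubfield L)))) (hS₀ : S₀ ⊆ S) (hram : ρ.ramFinsetH ⊆ S)
    (fS : TestS₀ L H ι T hT S) (fT : Unr₀ L H S)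
    {TH : UnitaryGroup.PureTensor₂ L (splitForm L 2) (splitForm L 1)} (hTH : TH.IsUnramified₂)
    (hchar : ∀ v : HeightOneSpectrum (𝓞 ↥(maximalRealSubfield L)),
      (𝔩 v).trPktH (νH v) (ρ.fin.loc v) (TH.loc v) = (𝔩 v).endoTrPkt ((νG' v).map (ψ v)) (ρ.fin.loc v) ((toPureTensor S fS fT).loc v ∘ (ψ v).symm))
    {FH : TestH L} (hFH : ⇑FH = TH.eval)
    (archTr' : GKIrrClass (uFormGroup (Fin 2) (Fin 1)) → (UnitaryGroup.arch (↥(maximalRealSubfield L)) L (IsCMField.complexConj L) 3 H → ℂ) → ℂ)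
    (harchId : 𝔞H.trPktInfH archTrH ρ.inf TH.arch = 𝔞H.endoTrPktInf archTr' ρ.inf fS.arch) :
    ρ.trH νH archTrH FH =
      ρ.trHSψ ψ S (fun v => (νG' v).map (ψ v)) archTr' fS *
        ∏ v ∈ fT.T, (((νG' v).real (cmLocalIntegralLevel L 3 H v : Set ((cmDatum L 3 H).Local v)) : ℂ) * ρ.evpHψ ψ (fun w => (νG' w).map (ψ w)) v (fT.loc v)) := by
  rw [ρ.trH_partner_eq_prod ψ h1 hadmH harch h1G h4 hadm S₀ hgood hψK hμK S hS₀ hram fS fT hTH hchar hFH, harchId, ρ.trHSψ_eq, mul_assoc]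
  congr 2
  rw [← Finset.prod_coe_sort S]
  exact Finset.prod_congr rfl fun v _ => by rw [locAll_of_mem fS fT v.2]

end Summit.HodgeConjecture.HodgeConjecture.Cruxes.H413.F0P3SpectralPacket.SpectralPacketH

end
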